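import Mathlib.Analysis.InnerProductSpace.Trace
import Literature.RepresentationTheory.CompactGroups.GelfandTrickOrbitalOperators
import Literature.NumberTheory.Automorphic.HilbertRepMultiplicitySpaceSchur
import Literature.NumberTheory.Automorphic.HilbertRepSchur
import Literature.RepresentationTheory.Semisimple.BurnsideIrreducible
import HarnessLib

/-!
# Multiplicity one of `K`-types from commuting orbital operators (the Gelfand-pair argument for `(G × K, ΔK)`)

Topic `Literature/RepresentationTheory/CompactGroups`; namespace `Literature.RepresentationTheory.CompactGroups` (continues
★ `GelfandTrickOrbitalOperators`).  Theorems and ONE auxiliary definition with body (`ContRepresentation.HomSpace.postCompOp`,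
post-composition on the multiplicity space); no named fact, no instance, no `sorry`.  GENERIC.

Let `π` be a unitary, strongly continuous, topologically irreducible representation of a topological group `G` on a complex
Hilbert space `X`, `K` a compact group with a two-sided and inversion invariant probability measure `μ`, `ι : K →* G` continuous,
and `O_x = ∫_K π(ιk·x·ιk⁻¹) dμ(k)` the orbital operators (★ `orbitalOp`).  For a finite-dimensional irreducible UNITARY
representation `τ` of `K` on `W`, the multiplicity space `Hom_K(τ, π∘ι)` (★ `ContRepresentation.HomSpace τ (π.restrict ι)`, a
Hilbert space for the Hilbert–Schmidt inner product `⟪S, T⟫ = Σᵢ ⟪S eᵢ, T eᵢ⟫`, ★ `HilbertRepMultiplicitySpace`) carries the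
bounded operators `S ↦ O_x ∘ S` (`postCompOp`), and:

**`exists_forall_homSpace_eq_smul_of_commute_orbitalOp`.  If the `O_x` pairwise commute, then `Hom_K(τ, π∘ι)` is at most
one-dimensional: `∃ S₀, ∀ S, ∃ c, S = c • S₀`** — multiplicity `≤ 1` of the `K`-type `τ` in `π`.

Proof (the Gelfand-pair argument for `(G × K, ΔK)` inside the multiplicity space): `𝒮 = {O_x ∘ ·}` is commutative,
adjoint-closed (`(O_x ∘ ·)† = O_{x⁻¹} ∘ ·`) and TOPOLOGICALLY IRREDUCIBLE on `Hom_K(τ, π∘ι)`: for a closed `𝒮`-stable `N` with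
`0 ≠ n ∈ N`, `0 ≠ T ⊥ N`, one has `0 = ⟪O_x ∘ n, T⟫ = ∫_K c(ιk x ιk⁻¹) dk = c(x)`, `c(y) = Σᵢ ⟪π(y) n eᵢ, T eᵢ⟫` being
`Ad K`-invariant (trace identity, `τ` unitary); Burnside for `τ` (★ `Semisimple.span_range_eq_top_of_isIrreducible`) upgrades
this to `⟪T eᵢ, π(x) n eⱼ⟫ = 0`, and irreducibility of `π` gives `T = 0`.  Schur for irreducible adjoint-closed families
(★ `IsIrreducibleFamily.exists_eq_algebraMap`) makes each `O_x ∘ ·` scalar, so every line `ℂ S₀` is `𝒮`-stable, hence everything.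

With ★ `commute_orbitalOp_of_antiHom` at the transpose of `U(2,1)` this is multiplicity one of `K`-types for irreducible unitary
representations of `U(2,1)` (Kraljević 1973; Koornwinder 1982) — Harish-Chandra's admissibility theorem there, sharp form.

* `ContRepresentation.HomSpace.postCompOp` (`S ↦ A ∘ S`), `eq_zero_of_forall_inner_rep_apply_eq_zero`,
  `isIrreducibleFamily_postCompOp_orbitalOp`, **`exists_forall_homSpace_eq_smul_of_commute_orbitalOp`** (multiplicity `≤ 1`).

References: [DeitmarEchterhoff2014] Lemma 6.1.7, §7.3 Lemma 7.3.1; [Helgason2000] Ch. IV §3 Thm. 3.1, Lemma 3.6;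
[HarishChandra1953] Thms. 4–6.  Provenance: cell `hodgecm-mathlib`, seat A-p14 (g27), road «T3 via Gelfand's trick», FILE B;
HC_CM is proved only modulo the printed citations until rung 0 closes; generic leaf, changes no count.
-/

noncomputable section

open MeasureTheory ContinuousLinearMap ContRepresentation
open Literature.NumberTheory.Automorphic Literature.RepresentationTheory.CompactGroups
open scoped InnerProductSpace ComplexConjugate

/-! ### Post-composition on the multiplicity space -/

namespace ContRepresentation

namespace HomSpace

variable {K : Type*} [Group K]
variable {X : Type*} [NormedAddCommGroup X] [InnerProductSpace ℂ X]
variable {W : Type*} [NormedAddCommGroup W] [InnerProductSpace ℂ W] [FiniteDimensional ℂ W]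
variable {τ : ContRepresentation ℂ K W} {ρ : ContRepresentation ℂ K X}

omit [FiniteDimensional ℂ W] in
/-- Post-composition by an operator `A` commuting with `ρ(K)` preserves the intertwiners `Hom_K(τ, ρ)`. [cite: DeitmarEchterhoff2014, Lemma 7.3.1] -/
theorem postCompOp_mem_intertwiners (A : X →L[ℂ] X) (hA : ∀ k : K, A ∘L ρ k = ρ k ∘L A) (S : HomSpace τ ρ) :
    A ∘L S.toCLM ∈ Schur.intertwiners τ ρ := fun k => by
  change ρ k ∘L (A ∘L S.toCLM) = (A ∘L S.toCLM) ∘L τ k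
  rw [← ContinuousLinearMap.comp_assoc, ← hA k, ContinuousLinearMap.comp_assoc, S.comp_toCLM k,
    ContinuousLinearMap.comp_assoc]

/-- **Post-composition** `S ↦ A ∘ S` on the multiplicity space `Hom_K(τ, ρ)` by a bounded operator `A` commuting with `ρ(K)`,
as a bounded operator for the Hilbert–Schmidt norm (`‖A ∘ S‖ ≤ ‖A‖ ‖S‖`, ★ `HomSpace.norm_mk_comp_le`).
(Deitmar–Echterhoff Lemma 7.3.1: the commutant of `ρ(K)` acts on `Hom_K(V_τ, V_ρ)`.) [cite: DeitmarEchterhoff2014, Lemma 7.3.1] -/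
def postCompOp (A : X →L[ℂ] X) (hA : ∀ k : K, A ∘L ρ k = ρ k ∘L A) : HomSpace τ ρ →L[ℂ] HomSpace τ ρ :=
  LinearMap.mkContinuous
    { toFun := fun S => HomSpace.mk (A ∘L S.toCLM) (postCompOp_mem_intertwiners A hA S)
      map_add' := fun S T => HomSpace.ext (by
        simp only [HomSpace.toCLM_mk, HomSpace.toCLM_add, ContinuousLinearMap.comp_add])
      map_smul' := fun c S => HomSpace.ext (by
        simp only [HomSpace.toCLM_mk, HomSpace.toCLM_smul, ContinuousLinearMap.comp_smul, RingHom.id_apply]) }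
    ‖A‖ fun S => HomSpace.norm_mk_comp_le A S _

/-- Unfolding `postCompOp` on operators: `(A ∘ S).toCLM = A ∘L S.toCLM`. [cite: DeitmarEchterhoff2014, Lemma 7.3.1] -/
@[simp]
theorem toCLM_postCompOp (A : X →L[ℂ] X) (hA : ∀ k : K, A ∘L ρ k = ρ k ∘L A) (S : HomSpace τ ρ) :
    (postCompOp A hA S).toCLM = A ∘L S.toCLM := rfl

/-- Post-compositions by commuting operators commute: `(A ∘ ·) (B ∘ ·) = (B ∘ ·) (A ∘ ·)` if `A B = B A`.
[cite: DeitmarEchterhoff2014, Lemma 7.3.1] -/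
theorem postCompOp_mul_postCompOp_comm (A B : X →L[ℂ] X) (hA : ∀ k : K, A ∘L ρ k = ρ k ∘L A)
    (hB : ∀ k : K, B ∘L ρ k = ρ k ∘L B) (hAB : A * B = B * A) :
    postCompOp (τ := τ) A hA * postCompOp B hB = postCompOp B hB * postCompOp A hA := by
  refine ContinuousLinearMap.ext fun S => HomSpace.ext ?_
  change (postCompOp (τ := τ) A hA (postCompOp B hB S)).toCLM = (postCompOp (τ := τ) B hB (postCompOp A hA S)).toCLM
  rw [toCLM_postCompOp, toCLM_postCompOp, toCLM_postCompOp, toCLM_postCompOp, ← ContinuousLinearMap.comp_assoc,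
    ← ContinuousLinearMap.mul_def, hAB, ContinuousLinearMap.mul_def, ContinuousLinearMap.comp_assoc]

/-- **The adjoint of `A ∘ ·` is `A† ∘ ·`** for the Hilbert–Schmidt inner product (`Σᵢ ⟪A† S eᵢ, T eᵢ⟫ = Σᵢ ⟪S eᵢ, A T eᵢ⟫`).
[cite: DeitmarEchterhoff2014, Lemma 7.3.1] -/
theorem adjoint_postCompOp [CompleteSpace X] (A : X →L[ℂ] X) (hA : ∀ k : K, A ∘L ρ k = ρ k ∘L A)
    (hA' : ∀ k : K, ContinuousLinearMap.adjoint A ∘L ρ k = ρ k ∘L ContinuousLinearMap.adjoint A) :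
    ContinuousLinearMap.adjoint (postCompOp (τ := τ) A hA) = postCompOp (ContinuousLinearMap.adjoint A) hA' := by
  symm
  rw [ContinuousLinearMap.eq_adjoint_iff]
  intro S T
  rw [HomSpace.inner_def, HomSpace.inner_def]
  refine Finset.sum_congr rfl fun i _ => ?_
  rw [toCLM_postCompOp, toCLM_postCompOp, ContinuousLinearMap.comp_apply, ContinuousLinearMap.comp_apply,
    ContinuousLinearMap.adjoint_inner_left]

end HomSpace

end ContRepresentation

namespace Literature.RepresentationTheory.CompactGroups

/-! ### Two Hilbert-space lemmas -/

section Hilbert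

variable {G : Type*} [Group G]
variable {X : Type*} [NormedAddCommGroup X] [InnerProductSpace ℂ X] [CompleteSpace X]
variable {π : ContRepresentation ℂ G X}

/-- For a unitary `π`: `⟪π g u, w⟫ = ⟪u, π g⁻¹ w⟫`. [cite: DeitmarEchterhoff2014, Lemma 6.1.7] -/
theorem inner_rep_apply_left (hU : π.IsUnitary) (g : G) (u w : X) : ⟪π g u, w⟫_ℂ = ⟪u, π g⁻¹ w⟫_ℂ := by
  rw [← hU.adjoint_apply g, ContinuousLinearMap.adjoint_inner_right]

/-- **In an irreducible unitary representation a vector orthogonal to the orbit of a non-zero vector vanishes**: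
`(∀ x, ⟪h, π x v⟫ = 0) → v ≠ 0 → h = 0` (the closed invariant subspace `{h | h ⊥ π(G) v}` is not everything, hence zero).
[cite: DeitmarEchterhoff2014, Lemma 6.1.7] -/
theorem eq_zero_of_forall_inner_rep_apply_eq_zero (hU : π.IsUnitary) (hirr : π.IsTopIrreducible) {v h : X} (hv : v ≠ 0)
    (h0 : ∀ x : G, ⟪h, π x v⟫_ℂ = 0) : h = 0 := by
  -- the closed invariant subspace of vectors orthogonal to the orbit of `v`
  let Z : ClosedSubrep π :=
    { toSubmodule :=
        { carrier := {w | ∀ x : G, ⟪w, π x v⟫_ℂ = 0}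
          add_mem' := fun {a b} ha hb x => by rw [inner_add_left, ha x, hb x, add_zero]
          zero_mem' := fun x => inner_zero_left _
          smul_mem' := fun c a ha x => by rw [inner_smul_left, ha x, mul_zero] }
      apply_mem_toSubmodule := fun g w hw x => by
        change ⟪π g w, π x v⟫_ℂ = 0
        rw [inner_rep_apply_left hU]
        change ⟪w, (π g⁻¹ * π x) v⟫_ℂ = 0
        rw [← map_mul]
        exact hw _
      isClosed' := by
        change IsClosed {w : X | ∀ x : G, ⟪w, π x v⟫_ℂ = 0}
        rw [Set.setOf_forall]
        exact isClosed_iInter fun x => isClosed_eq (continuous_id.inner continuous_const) continuous_const }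
  rcases ((isTopIrreducible_iff π).mp hirr).2 Z with hZ | hZ
  · have hh : h ∈ Z := h0
    rw [hZ] at hh
    exact (ClosedSubrep.mem_bot).mp hh
  · have hvZ : v ∈ Z := by rw [hZ]; exact ClosedSubrep.mem_top v
    have h1 := hvZ 1
    rw [map_one] at h1
    change ⟪v, v⟫_ℂ = 0 at h1
    rw [inner_self_eq_zero] at h1
    exact absurd h1 hv

end Hilbert

/-! ### A trace identity: `Σᵢ ⟪P (u eᵢ), Q (u eᵢ)⟫ = Σᵢ ⟪P eᵢ, Q eᵢ⟫` for a co-isometry `u` -/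

section Trace

variable {X : Type*} [NormedAddCommGroup X] [InnerProductSpace ℂ X] [CompleteSpace X]
variable {W : Type*} [NormedAddCommGroup W] [InnerProductSpace ℂ W] [FiniteDimensional ℂ W]

/-- `Σᵢ ⟪P fᵢ, Q fᵢ⟫ = tr(P† Q)` over any orthonormal basis `(fᵢ)`. [cite: DeitmarEchterhoff2014, Lemma 7.3.1] -/
theorem sum_inner_apply_eq_trace {ι' : Type*} [Fintype ι'] (b : OrthonormalBasis ι' ℂ W) (P Q : W →L[ℂ] X) :
    ∑ i, ⟪P (b i), Q (b i)⟫_ℂ = LinearMap.trace ℂ W ((ContinuousLinearMap.adjoint P ∘L Q : W →L[ℂ] W) : W →ₗ[ℂ] W) := by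
  rw [LinearMap.trace_eq_sum_inner _ b]
  refine Finset.sum_congr rfl fun i _ => ?_
  rw [ContinuousLinearMap.coe_coe, ContinuousLinearMap.comp_apply, ContinuousLinearMap.adjoint_inner_right]

/-- **Change of orthonormal basis by a co-isometry**: for `u ∘ u† = 1` on the finite-dimensional `W`,
`Σᵢ ⟪P (u eᵢ), Q (u eᵢ)⟫ = Σᵢ ⟪P eᵢ, Q eᵢ⟫` (`= tr(u† P†Q u) = tr(P†Q u u†) = tr(P†Q)`). [cite: DeitmarEchterhoff2014, Lemma 7.3.1] -/
theorem sum_inner_comp_eq_of_mul_adjoint_eq_one {ι' : Type*} [Fintype ι'] (b : OrthonormalBasis ι' ℂ W) (P Q : W →L[ℂ] X)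
    (u : W →L[ℂ] W) (hu : u * ContinuousLinearMap.adjoint u = 1) :
    ∑ i, ⟪P (u (b i)), Q (u (b i))⟫_ℂ = ∑ i, ⟪P (b i), Q (b i)⟫_ℂ := by
  have h1 : ∑ i, ⟪P (u (b i)), Q (u (b i))⟫_ℂ = ∑ i, ⟪(P ∘L u) (b i), (Q ∘L u) (b i)⟫_ℂ := by
    simp only [ContinuousLinearMap.comp_apply]
  rw [h1, sum_inner_apply_eq_trace, sum_inner_apply_eq_trace, ContinuousLinearMap.adjoint_comp]
  have h2 : ((ContinuousLinearMap.adjoint u ∘L ContinuousLinearMap.adjoint P) ∘L (Q ∘L u) : W →L[ℂ] W) =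
      ContinuousLinearMap.adjoint u * ((ContinuousLinearMap.adjoint P ∘L Q) ∘L u) := by
    rw [ContinuousLinearMap.mul_def]
    simp only [ContinuousLinearMap.comp_assoc]
  have hcoe : ∀ A B : W →L[ℂ] W, ((A * B : W →L[ℂ] W) : W →ₗ[ℂ] W) = (A : W →ₗ[ℂ] W) * (B : W →ₗ[ℂ] W) :=
    fun A B => rfl
  rw [h2, hcoe, LinearMap.trace_mul_comm, ← hcoe, ContinuousLinearMap.mul_def, ContinuousLinearMap.comp_assoc,
    ← ContinuousLinearMap.mul_def u, hu, ContinuousLinearMap.one_def, ContinuousLinearMap.comp_id]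

end Trace

/-! ### Irreducibility of the orbital operators on the multiplicity space, and multiplicity one -/

section Main

variable {G : Type*} [Group G] [TopologicalSpace G] [IsTopologicalGroup G]
variable {K : Type*} [Group K] [TopologicalSpace K] [IsTopologicalGroup K] [CompactSpace K]
  [MeasurableSpace K] [BorelSpace K]
variable {μ : Measure K} [IsProbabilityMeasure μ]
variable {ι : K →* G}
variable {X : Type*} [NormedAddCommGroup X] [InnerProductSpace ℂ X] [CompleteSpace X]
variable {π : ContRepresentation ℂ G X}
variable {hι : Continuous ι} {hπ : π.IsStronglyContinuous} {hU : π.IsUnitary}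
variable {W : Type*} [NormedAddCommGroup W] [InnerProductSpace ℂ W] [FiniteDimensional ℂ W]
variable {τ : ContRepresentation ℂ K W}

/-- The orbital operators commute with the restricted representation `π ∘ ι` of `K` (★ `apply_orbitalOp`).
[cite: Helgason2000, Ch. IV §3 Thm. 3.1] -/
theorem orbitalOp_comp_restrict [μ.IsMulLeftInvariant] (x : G) (k : K) :
    orbitalOp μ ι π hι hπ hU x ∘L (π.restrict ι) k = (π.restrict ι) k ∘L orbitalOp μ ι π hι hπ hU x := by
  refine ContinuousLinearMap.ext fun v => ?_
  rw [ContinuousLinearMap.comp_apply, ContinuousLinearMap.comp_apply, ContRepresentation.restrict_apply,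
    apply_orbitalOp]

omit [Group K] [TopologicalSpace K] [IsTopologicalGroup K] [CompactSpace K] [BorelSpace K] [IsProbabilityMeasure μ] in
/-- Inner products with a Bochner integral in the first slot: `⟪∫ f, w⟫ = ∫ ⟪f k, w⟫`. [cite: DeitmarEchterhoff2014, Lemma 6.1.7] -/
theorem inner_bochner_integral_left {f : K → X} (hf : Integrable f μ) (w : X) :
    ⟪∫ k, f k ∂μ, w⟫_ℂ = ∫ k, ⟪f k, w⟫_ℂ ∂μ := by
  rw [← inner_conj_symm, ← integral_inner hf, ← integral_conj]
  exact integral_congr_ae (Filter.Eventually.of_forall fun k => inner_conj_symm _ _)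

/-- **The orbital operators act irreducibly on the multiplicity space** `Hom_K(τ, π∘ι)` of an irreducible unitary `τ` in an
irreducible unitary `π` (the Gelfand-pair argument for `(G × K, ΔK)`; module docstring). [cite: Helgason2000, Ch. IV §3 Thm. 3.1]
[cite: DeitmarEchterhoff2014, Lemma 7.3.1] -/
theorem isIrreducibleFamily_postCompOp_orbitalOp [μ.IsMulLeftInvariant] (hirr : π.IsTopIrreducible)
    (hτu : ∀ (k : K) (v w : W), ⟪τ k v, τ k w⟫_ℂ = ⟪v, w⟫_ℂ) [τ.toRepresentation.IsIrreducible] :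
    IsIrreducibleFamily (Set.range fun x : G =>
      HomSpace.postCompOp (τ := τ) (orbitalOp μ ι π hι hπ hU x) (orbitalOp_comp_restrict x)) := by
  classical
  intro N hNc hNinv
  by_contra hne
  push Not at hne
  obtain ⟨n, hnN, hn0⟩ := (Submodule.ne_bot_iff N).mp hne.1
  haveI : CompleteSpace N := hNc.completeSpace_coe
  have hNo : Nᗮ ≠ ⊥ := fun h => hne.2 (Submodule.orthogonal_eq_bot_iff.mp h)
  obtain ⟨T, hTN, hT0⟩ := (Submodule.ne_bot_iff Nᗮ).mp hNo
  set e := stdOrthonormalBasis ℂ W with he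
  set O : G → X →L[ℂ] X := orbitalOp μ ι π hι hπ hU with hO
  -- equivariance of `n` and `T`, on vectors
  have hn_eq : ∀ (k : K) (w : W), π (ι k) (n.toCLM w) = n.toCLM (τ k w) := fun k w => n.apply_toCLM_apply k w
  have hT_eq : ∀ (k : K) (w : W), π (ι k) (T.toCLM w) = T.toCLM (τ k w) := fun k w => T.apply_toCLM_apply k w
  -- the coefficient function `c(y) = Σᵢ ⟪π y (n eᵢ), T eᵢ⟫`
  set c : G → ℂ := fun y => ∑ i, ⟪π y (n.toCLM (e i)), T.toCLM (e i)⟫_ℂ with hc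
  -- (1) `⟪O_x ∘ n, T⟫ = 0`
  have h1 : ∀ x : G, ⟪HomSpace.postCompOp (τ := τ) (O x) (orbitalOp_comp_restrict x) n, T⟫_ℂ = 0 := fun x =>
    (Submodule.mem_orthogonal N T).mp hTN _ (hNinv _ ⟨x, rfl⟩ n hnN)
  -- (2) `⟪O_x ∘ n, T⟫ = ∫ c(ιk x ιk⁻¹) dk`
  have h2 : ∀ x : G, ⟪HomSpace.postCompOp (τ := τ) (O x) (orbitalOp_comp_restrict x) n, T⟫_ℂ =
      ∫ k, c (ι k * x * (ι k)⁻¹) ∂μ := by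
    intro x
    rw [HomSpace.inner_def, hc]
    simp only [HomSpace.toCLM_postCompOp, ContinuousLinearMap.comp_apply, hO, orbitalOp_apply]
    rw [integral_finsetSum _ fun i _ =>
      ((continuous_repConjOrbit ι π hι hπ x _).inner continuous_const).integrable_of_hasCompactSupport
        (HasCompactSupport.of_compactSpace _)]
    exact Finset.sum_congr rfl fun i _ => inner_bochner_integral_left (integrable_repConjOrbit μ ι π hι hπ x _) _
  -- (3) `c` is `Ad K`-invariant
  have h3 : ∀ (x : G) (k : K), c (ι k * x * (ι k)⁻¹) = c x := by
    intro x k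
    simp only [hc]
    have hstep : ∀ i, ⟪π (ι k * x * (ι k)⁻¹) (n.toCLM (e i)), T.toCLM (e i)⟫_ℂ =
        ⟪(π x ∘L n.toCLM) (τ k⁻¹ (e i)), T.toCLM (τ k⁻¹ (e i))⟫_ℂ := by
      intro i
      rw [map_mul, map_mul]
      change ⟪π (ι k) (π x (π (ι k)⁻¹ (n.toCLM (e i)))), T.toCLM (e i)⟫_ℂ = _
      rw [inner_rep_apply_left hU, ← map_inv, hn_eq, hT_eq, ContinuousLinearMap.comp_apply]
    simp only [hstep]
    have hadj : ContinuousLinearMap.adjoint (τ k⁻¹) = τ k⁻¹⁻¹ := HomSpace.adjoint_eq_inv_of_inner_map_map hτu k⁻¹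
    have hco : τ k⁻¹ * ContinuousLinearMap.adjoint (τ k⁻¹) = 1 := by
      rw [hadj, inv_inv, ← map_mul, inv_mul_cancel, map_one]
    rw [sum_inner_comp_eq_of_mul_adjoint_eq_one e (π x ∘L n.toCLM) T.toCLM (τ k⁻¹) hco]
    simp only [ContinuousLinearMap.comp_apply]
  -- (4) `c x = 0`
  have h4 : ∀ x : G, c x = 0 := by
    intro x
    have h := h1 x
    rw [h2 x] at h
    simp only [h3 x] at h
    rw [integral_const, probReal_univ, one_smul] at h
    exact h
  -- (5) Burnside: `⟪T eᵢ, π x (n eⱼ)⟫ = 0` for all `i j x`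
  have h5 : ∀ (x : G) (i j : Fin (Module.finrank ℂ W)), ⟪T.toCLM (e i), π x (n.toCLM (e j))⟫_ℂ = 0 := by
    intro x i j
    -- the linear functional `A ↦ Σ_l ⟪T e_l, π x (n (A e_l))⟫` on `End W` kills every `τ k`, hence everything
    let L : Module.End ℂ W →ₗ[ℂ] ℂ :=
      { toFun := fun A => ∑ l, ⟪T.toCLM (e l), π x (n.toCLM (A (e l)))⟫_ℂ
        map_add' := fun A B => by
          rw [← Finset.sum_add_distrib]
          refine Finset.sum_congr rfl fun l _ => ?_
          rw [LinearMap.add_apply, map_add, map_add, inner_add_right]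
        map_smul' := fun a A => by
          rw [RingHom.id_apply, Finset.smul_sum]
          refine Finset.sum_congr rfl fun l _ => ?_
          rw [LinearMap.smul_apply, map_smul, map_smul, inner_smul_right, smul_eq_mul] }
    set ρτ : Representation ℂ K W := τ.toRepresentation with hρτ
    have hρτk : ∀ (k : K) (w : W), ρτ k w = τ k w := fun k w => rfl
    have hLτ : ∀ k : K, L (ρτ k) = 0 := by
      intro k
      change ∑ l, ⟪T.toCLM (e l), π x (n.toCLM (ρτ k (e l)))⟫_ℂ = 0
      have : ∑ l, ⟪T.toCLM (e l), π x (n.toCLM (ρτ k (e l)))⟫_ℂ = conj (c (x * ι k)) := by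
        rw [hc, map_sum]
        refine Finset.sum_congr rfl fun l _ => ?_
        rw [inner_conj_symm, hρτk, ← hn_eq, map_mul]
        rfl
      rw [this, h4, map_zero]
    have hLall : ∀ A : Module.End ℂ W, L A = 0 := by
      intro A
      have hA : A ∈ Submodule.span ℂ (Set.range fun k : K => (ρτ k : Module.End ℂ W)) := by
        rw [Semisimple.span_range_eq_top_of_isIrreducible ρτ]; exact Submodule.mem_top
      have hle : Submodule.span ℂ (Set.range fun k : K => (ρτ k : Module.End ℂ W)) ≤ LinearMap.ker L := by
        rw [Submodule.span_le]
        rintro _ ⟨k, rfl⟩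
        exact (LinearMap.mem_ker).mpr (hLτ k)
      exact (LinearMap.mem_ker).mp (hle hA)
    -- the rank-one map `e_l ↦ ⟪e j, e_l⟫ e_i`… precisely `A e_l = ⟪e_j', e_l⟫ • e_i'` with `(i', j') = (j, i)`:
    have hA := hLall (((innerSL ℂ (e i)).smulRight (e j) : W →L[ℂ] W) : Module.End ℂ W)
    change ∑ l, ⟪T.toCLM (e l), π x (n.toCLM (((innerSL ℂ (e i)).smulRight (e j) : W →L[ℂ] W) (e l)))⟫_ℂ = 0 at hA
    simp only [ContinuousLinearMap.smulRight_apply, innerSL_apply_apply, map_smul, inner_smul_right] at hA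
    have horth : ∀ l, ⟪e i, e l⟫_ℂ = if i = l then (1 : ℂ) else 0 := fun l => orthonormal_iff_ite.mp e.orthonormal i l
    simp only [horth, ite_mul, one_mul, zero_mul, Finset.sum_ite_eq, Finset.mem_univ, if_true] at hA
    exact hA
  -- (6) `T = 0`: pick `j` with `n eⱼ ≠ 0` and use the irreducibility of `π`
  have hnj : ∃ j, n.toCLM (e j) ≠ 0 := by
    by_contra hall
    push Not at hall
    apply hn0
    refine HomSpace.ext ?_
    rw [HomSpace.toCLM_zero]
    refine ContinuousLinearMap.coe_injective (e.toBasis.ext fun j => ?_)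
    rw [OrthonormalBasis.coe_toBasis, ContinuousLinearMap.coe_coe, hall j, ContinuousLinearMap.coe_coe]
    rfl
  obtain ⟨j, hj⟩ := hnj
  apply hT0
  refine HomSpace.ext ?_
  rw [HomSpace.toCLM_zero]
  refine ContinuousLinearMap.coe_injective (e.toBasis.ext fun i => ?_)
  rw [OrthonormalBasis.coe_toBasis, ContinuousLinearMap.coe_coe, ContinuousLinearMap.coe_coe]
  exact eq_zero_of_forall_inner_rep_apply_eq_zero hU hirr hj fun x => h5 x i j

/-- **Multiplicity one of `K`-types from commuting orbital operators.**  Let `π` be unitary, strongly continuous and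
topologically irreducible, `τ` a finite-dimensional irreducible unitary representation of the compact group `K`, and suppose the
orbital operators `O_x = ∫_K π(ιk x ιk⁻¹) dμ(k)` pairwise commute (e.g. by Gelfand's trick ★ `commute_orbitalOp_of_antiHom`).
Then `Hom_K(τ, π∘ι)` is at most a line: `∃ S₀, ∀ S, ∃ c, S = c • S₀`.  (Helgason Ch. IV: for a Gelfand pair the spherical
vectors of an irreducible unitary representation form at most a line; here for `(G × K, ΔK)` and the `K`-type `τ`.)
[cite: Helgason2000, Ch. IV §3 Thm. 3.1] [cite: HarishChandra1953, Thms. 4–6] -/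
theorem exists_forall_homSpace_eq_smul_of_commute_orbitalOp [SecondCountableTopology K] [μ.IsMulLeftInvariant]
    [μ.IsMulRightInvariant] [μ.IsInvInvariant] (hirr : π.IsTopIrreducible)
    (hcomm : ∀ x y : G, Commute (orbitalOp μ ι π hι hπ hU x) (orbitalOp μ ι π hι hπ hU y))
    (hτu : ∀ (k : K) (v w : W), ⟪τ k v, τ k w⟫_ℂ = ⟪v, w⟫_ℂ) [τ.toRepresentation.IsIrreducible] :
    ∃ S₀ : HomSpace τ (π.restrict ι), ∀ S : HomSpace τ (π.restrict ι), ∃ c : ℂ, S = c • S₀ := by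
  classical
  set Sx : G → (HomSpace τ (π.restrict ι) →L[ℂ] HomSpace τ (π.restrict ι)) :=
    fun x => HomSpace.postCompOp (τ := τ) (orbitalOp μ ι π hι hπ hU x)
      (orbitalOp_comp_restrict (μ := μ) (ι := ι) (π := π) (hι := hι) (hπ := hπ) (hU := hU) x) with hSx
  have hfam : IsIrreducibleFamily (Set.range Sx) := isIrreducibleFamily_postCompOp_orbitalOp hirr hτu
  -- the family is adjoint-closed and commutative, hence scalar (Schur)
  have hadj : ∀ x : G, ContinuousLinearMap.adjoint (Sx x) = Sx x⁻¹ := by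
    intro x
    have hA' : ∀ k : K, ContinuousLinearMap.adjoint (orbitalOp μ ι π hι hπ hU x) ∘L (π.restrict ι) k =
        (π.restrict ι) k ∘L ContinuousLinearMap.adjoint (orbitalOp μ ι π hι hπ hU x) := fun k => by
      rw [adjoint_orbitalOp]; exact orbitalOp_comp_restrict x⁻¹ k
    simp only [hSx]
    rw [HomSpace.adjoint_postCompOp _ _ hA']
    congr 1
    exact adjoint_orbitalOp x
  have hscal : ∀ x : G, ∃ a : ℂ, Sx x = algebraMap ℂ _ a := by
    intro x
    refine hfam.exists_eq_algebraMap ?_ ?_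
    · rintro _ ⟨y, rfl⟩
      exact ⟨y⁻¹, (hadj y).symm⟩
    · rintro _ ⟨y, rfl⟩
      change Sx y * Sx x = Sx x * Sx y
      simp only [hSx]
      exact HomSpace.postCompOp_mul_postCompOp_comm _ _ _ _ (hcomm y x).eq
  -- every line is stable and closed, hence everything
  by_cases h0 : ∀ S : HomSpace τ (π.restrict ι), S = 0
  · exact ⟨0, fun S => ⟨0, by rw [h0 S, zero_smul]⟩⟩
  push Not at h0
  obtain ⟨S₀, hS₀⟩ := h0
  refine ⟨S₀, fun S => ?_⟩
  have hline := hfam (ℂ ∙ S₀) (Submodule.closed_of_finiteDimensional _) (by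
    rintro _ ⟨x, rfl⟩ v hv
    obtain ⟨a, ha⟩ := hscal x
    rw [ha, ContinuousLinearMap.algebraMap_apply]
    exact Submodule.smul_mem _ a hv)
  rcases hline with hbot | htop
  · exact absurd ((Submodule.span_singleton_eq_bot).mp hbot) hS₀
  · have hS : S ∈ (ℂ ∙ S₀) := by rw [htop]; exact Submodule.mem_top
    obtain ⟨a, ha⟩ := Submodule.mem_span_singleton.mp hS
    exact ⟨a, ha.symm⟩

end Main

end Literature.RepresentationTheory.CompactGroups

end
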